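import Summits.AtomisticToContinuum.Crystallization.Theorems.ChartedZeroExcessLayeredLatticeLiouvilleYS

/-!
# Part YV «RigidReference» (lens-2 g72): the reference IS the comparison crystal — class-robust EXACT transport; pieces (XR♯) / (Gl♯) / (Gp♯) / (Gh♯)

Docket `stmt-AtomisticToContinuum-26636` (N = `…Theses.ChartedPlanarOrder.ChartedZeroExcessLayered`), cell decomp-a2c RESIDUAL MODE, lens-2
«structural dichotomy (special vs generic)», generation 72.  Imports part YS (g70, built).  SUPERSEDES the held parts YT/YU of g71 (critic row 1295:
(Gr) `PatchRegistrationP` FALSE AS TYPED — shell-crossing defect of the exact relation clauses; re-type ordered): instead of re-typing the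
registration of a bent reference to a perfect patch, the lens is applied ONE LEVEL UP, to the REFERENCE CLASS — the reference `y₀` IS the site list
of a placed perfect clamped patch, so the comparison map is the identity.  This part: definitions, the bootstrap engines of YT §YT-3 (carried
verbatim, YT being retired), and the four typed pieces; part YW: the junctions down to (QE) (all PROVED).  Every constant symbolic; 0 sorry.

## Why one level up (three defects of registering a BENT reference, at the frozen literals `(r, q, rsh, ρ, rm, dm) = (8, 4, 12, 16, 16, 1/2)`)
(Gr-1, row 1295) sharp `Rg`/`Rφ`/class relations of TWO point sets cannot agree over the clean scale window (shell crossings) — with `Y = y₀` the pair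
relations are LITERALLY shared and only the interface class needs a SANDWICH (§YV-2 (S1)/(S2)); (Gr-2) one global frame within `ϑr ≤ 1/1860` over
diameter `56` — a rigid reference is one frame BY FIAT, the price being its interface misfit `ε, ϑ₀ ≈ (ϑc/4)·(ρ + Rg)` (uniform collar strain over the
lever arm), FREE in the `∃ ϑm` column `_16XH28BVT` (`VariationalMildDocket.of_le`) though NOT at the record `ϑm = 1/2000`; (Gr-3, new) g71's (v)/(vi)
match exterior `Rg`-stars in RELATIVE `ϑr`, reaching `dist(·, K) ≤ ρ + dm + Rg > r + rsh = 20` for every admissible `Rg ≥ 4 + 2dB` (part YP) — WARM,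
merely θ-good atoms — and (Gp)'s unregistered far core–core tail wants `Rg ≳ 9.5` (g71 canary F13): the dial window is EMPTY.  With a rigid reference
the core–core part of the stiffness defect `H − A` (same interaction energy, same point) vanishes IDENTICALLY, the whole cool zone is matched ABSOLUTELY
(`ε`, no radius), and warm atoms enter only through `|D²V|` at distance `≥ r + rsh − ρ − dm − depth`: forecast rows close at the record `Rg = 5`.

## The pieces (this part; tags) — node (Gh♯) ⟸ (Gl♯) ∧ (Gp♯) ∧ Neumann-1 and the chain to (QE) are PROVED in part YW
  (XR♯) `RigidReferenceP … ε Rl Ru …`           [SPECIAL∃ · KINEMATIC · ATTACKABLE · STRONGER than (XR) (YW: PROVED ⇒ (XR)) · «RigidFit-T»]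
  (Gl♯) `PlacedPerfectResponseP q ρi ρo Rl Ru Rg Rφ G …` [SPECIAL · CERT-type · CONFIGURATION-FREE · FAT patches only (row 1295 (Gl-∀)) · every
                                                  sandwiched interface class (row 1295 (ρ1′), here for the class; pairs need none) · «GreenRow-T(perfect, band)»]
  (Gp♯) `CollarPinDriftP … ε Rl Ru κ …`          [GENERIC · ANALYTIC · FORWARD · ATTACKABLE · site-diagonal pin mismatch, `κg = 0` admissible · «PinDrift-R»]
  (Gh♯) `RigidHarmonicResponseP … ε Rl Ru H …`   [(Gh) of part YS RESTRICTED to rigid collar-registered references; WEAKER than (Gh) (YW: PROVED)]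
* `A` IS PINNED, NOT CHOSEN: (Gl♯) produces `∃ A, HasFDerivAt (D E_{X′}) A Y` at a placed perfect patch; (Gp♯) consumes `∀ A, HasFDerivAt … A y₀ →`.
* FATNESS IS DERIVED, NOT ASSUMED (YW `isFatPatch_of_rigid`): inner radius `ρ − ε` from (M2) (an unmatched crystal site inside the core region would have
  an actual partner in `S ∖ core` within `ρ` of `K`), outer radius `ρ + dm` from the matching clause of `IsTubeReference`.

## Pre-registered forecast (not a verdict; census «GreenRow-T(perfect, band)» G and «PinDrift-R» κ decide)
LJ: `V″(a₀) = 10.64`, `|V‴(a₀)| ≈ 207`, half-space pin tail `π(d) ≈ 0.07·(4/d)⁵`.  `κI/dI ≈ 1200·ε + 2π(3.5 + t)` (`≈ 0.33` at `ε ≤ 5·10⁻⁵`, outermost sites),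
`κb/dB ≈ 2π(4 + t_B)`, `t_B ≥ Rg − 1` (`≈ 4.4·10⁻³` at `Rg = 5`), `κg = 0`; with the g70 row forecast (`GI_I ≈ 0.3`, `GI_b ≈ 3`, `GB_b ≈ 25`) all Neumann rows
close at `Rg = 5`, `qN = 1/2` (interface `0.10 + 0.013`, bulk `0.11 + GB_I·2.5·10⁻³·dI/dB`); open number `GB_I`; moat dial `ϑm ≈ ε/5 ≈ 10⁻⁵`.

## Sources
parts YO ((XR), `IsTubeReference`), YOA (tube), YP (`Rg ≥ 4 + 2dB`), YQ v2 (currency), YS ((Gh), `mem_bondTube_of_forall_gt`), held YT of g71 (engines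
§YT-3 verbatim; (Gl)/(Gp) templates), YI (`VariationalMildDocket.of_le`, column `_16XH28BVT`); E–Ming, ARMA 183 (2007) §2; Ortner–Theil, ARMA 207 (2013)
§6; Ehrlacher–Ortner–Shapeev, ARMA 222 (2016); Braun–Schmidt arXiv:1604.00197; F. John, CPAM 14 (1961); CRITIC-LEDGER rows 1272, 1274, 1283, 1295.
-/

noncomputable section
open scoped BigOperators Classical InnerProductSpace RealInnerProductSpace
open MeasureTheory Set Metric Filter Topology
open Summit.AtomisticToContinuum.Crystallization.Theorems.ChartedPlanarOrderRigidityDoor (E3 eStar atomsIn IsEStarGSC siteEnergy VisibleGap PertRegime)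
open Summit.AtomisticToContinuum.Crystallization.Theorems.ChartedPlanarOrderDensityDichotomy (μS IsSep nK nK_nonneg)
open Summit.AtomisticToContinuum.Crystallization.Theorems.ChartedPlanarOrderCleanScaleP (IsCleanP IsDoorSetP)
open Summit.AtomisticToContinuum.Crystallization.Theorems.ChartedPlanarOrderMesoCut (LayeredHom EnvClose)
open Summit.AtomisticToContinuum.Crystallization.Theorems.ChartedPlanarOrderDoorLayered (atomsIn_subset sq_le_finsum_mem PeriodicBulkGapDoor)
open Summit.AtomisticToContinuum.Crystallization.Theorems.ChartedPlanarOrderDoorLayeredOsc (IsTwoShellAffineGood)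
open Literature.MathematicalPhysics.StatisticalMechanics (card_le_of_separated_of_dist_le lennardJones interactionEnergy)

namespace Summit.AtomisticToContinuum.Crystallization.Theorems.ChartedZeroExcessLayeredLatticeLiouville

/-! ### YV-0  The linear Neumann bootstrap from an arbitrary start gauge (PROVED; carried verbatim from the retired part YT §YT-3 of g71) -/

section Engines

variable {n : ℕ}

/-- bond deviation of a displaced configuration = the bond difference of the displacement. [YT g71, carried g72] -/
theorem dist_add_sub_add_sub (y u : Fin n → E3) (i j : Fin n) : dist ((y + u) i - (y + u) j) (y i - y j) = ‖u i - u j‖ := by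
  rw [dist_eq_norm]; congr 1; simp only [Pi.add_apply]; abel

/-- site deviation of a displaced configuration = the displacement. [YT g71, carried g72] -/
theorem dist_add_self (y u : Fin n → E3) (i : Fin n) : dist ((y + u) i) (y i) = ‖u i‖ := by
  rw [dist_eq_norm, Pi.add_apply, add_sub_cancel_left]

/-- ★ **THE LINEAR BOOTSTRAP (PROVED)**: a predicate on gauges that is monotone, closed from above, true at SOME gauge `t`, and improved by the affine
contraction `l ↦ m + qN·l` (`0 ≤ qN < 1`, `m ≥ 0`) on `[0, ∞)`, holds at the fixed point `m/(1 − qN)`. [YT g71, carried g72] -/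
theorem linear_bootstrap {P : ℝ → Prop} {m qN t : ℝ} (hm : 0 ≤ m) (hq0 : 0 ≤ qN) (hq1 : qN < 1)
    (hmono : ∀ l l' : ℝ, l ≤ l' → P l → P l') (hclosed : ∀ l : ℝ, (∀ l' : ℝ, l < l' → P l') → P l) (ht : P t)
    (hstep : ∀ l : ℝ, 0 ≤ l → P l → P (m + qN * l)) : P (m / (1 - qN)) := by
  have h1q : 0 < 1 - qN := sub_pos.2 hq1
  have hL0 : 0 ≤ m / (1 - qN) := div_nonneg hm h1q.le
  have hmL : m = m / (1 - qN) * (1 - qN) := (div_mul_cancel₀ m h1q.ne').symm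
  rcases le_or_gt t (m / (1 - qN)) with hle | hgt
  · exact hmono _ _ hle ht
  have htL : 0 < t - m / (1 - qN) := sub_pos.2 hgt
  have hiter : ∀ k : ℕ, P (m / (1 - qN) + qN ^ k * (t - m / (1 - qN))) := by
    intro k
    induction k with
    | zero => rw [show m / (1 - qN) + qN ^ 0 * (t - m / (1 - qN)) = t by ring]; exact ht
    | succ k ih =>
      have hlo : 0 ≤ m / (1 - qN) + qN ^ k * (t - m / (1 - qN)) := add_nonneg hL0 (mul_nonneg (pow_nonneg hq0 k) htL.le)
      have h := hstep _ hlo ih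
      have e : m + qN * (m / (1 - qN) + qN ^ k * (t - m / (1 - qN))) = m / (1 - qN) + qN ^ (k + 1) * (t - m / (1 - qN)) := by
        rw [pow_succ]; nth_rewrite 1 [hmL]; ring
      rwa [e] at h
  refine hclosed _ fun l' hl' => ?_
  obtain ⟨k, hk⟩ := exists_pow_lt_of_lt_one (div_pos (sub_pos.2 hl') htL) hq1
  refine hmono _ _ ?_ (hiter k)
  have h := mul_lt_mul_of_pos_right hk htL
  rw [div_mul_cancel₀ _ htL.ne'] at h
  linarith

variable {X : Set E3} {Rg sb dI dB : ℝ} {y₀ : Fin n → E3}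

/-- ★ **EVERY DISPLACEMENT HAS A FINITE GAUGE (PROVED)**: `y₀ + u` lies in the tube of gauge `t = 2T/sb + T/dI + T/dB`, `T = Σᵢ ‖u i‖` (positive radii).
[YT g71, carried g72] -/
theorem exists_gauge_mem_bondTube (hsb : 0 < sb) (hdI : 0 < dI) (hdB : 0 < dB) (u : Fin n → E3) :
    ∃ t : ℝ, 0 ≤ t ∧ y₀ + u ∈ bondTube X Rg (t * sb) (t * dI) (t * dB) y₀ := by
  have hT0 : 0 ≤ ∑ i, ‖u i‖ := Finset.sum_nonneg fun i _ => norm_nonneg _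
  have hTi : ∀ i, ‖u i‖ ≤ ∑ j, ‖u j‖ := fun i => Finset.single_le_sum (fun j _ => norm_nonneg (u j)) (Finset.mem_univ i)
  have hdiv : 0 ≤ (∑ i, ‖u i‖) / dI + (∑ i, ‖u i‖) / dB := add_nonneg (div_nonneg hT0 hdI.le) (div_nonneg hT0 hdB.le)
  refine ⟨2 * (∑ i, ‖u i‖) / sb + (∑ i, ‖u i‖) / dI + (∑ i, ‖u i‖) / dB, add_nonneg (add_nonneg (by positivity) (div_nonneg hT0 hdI.le))
    (div_nonneg hT0 hdB.le), fun i j _ => ?_, fun i _ => ?_, fun i => ?_⟩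
  · rw [dist_add_sub_add_sub]
    have e : (2 * (∑ i, ‖u i‖) / sb + (∑ i, ‖u i‖) / dI + (∑ i, ‖u i‖) / dB) * sb =
        2 * (∑ i, ‖u i‖) + ((∑ i, ‖u i‖) / dI + (∑ i, ‖u i‖) / dB) * sb := by
      rw [add_assoc, add_mul, div_mul_cancel₀ _ hsb.ne']
    rw [e]
    calc ‖u i - u j‖ ≤ ‖u i‖ + ‖u j‖ := norm_sub_le _ _
      _ ≤ 2 * ∑ i, ‖u i‖ := by linarith [hTi i, hTi j]
      _ ≤ 2 * (∑ i, ‖u i‖) + ((∑ i, ‖u i‖) / dI + (∑ i, ‖u i‖) / dB) * sb := le_add_of_nonneg_right (mul_nonneg hdiv hsb.le)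
  · rw [dist_add_self]
    have e : (2 * (∑ i, ‖u i‖) / sb + (∑ i, ‖u i‖) / dI + (∑ i, ‖u i‖) / dB) * dI =
        (∑ i, ‖u i‖) + (2 * (∑ i, ‖u i‖) / sb + (∑ i, ‖u i‖) / dB) * dI := by
      rw [show 2 * (∑ i, ‖u i‖) / sb + (∑ i, ‖u i‖) / dI + (∑ i, ‖u i‖) / dB =
        (∑ i, ‖u i‖) / dI + (2 * (∑ i, ‖u i‖) / sb + (∑ i, ‖u i‖) / dB) by ring, add_mul, div_mul_cancel₀ _ hdI.ne']
    rw [e]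
    exact (hTi i).trans (le_add_of_nonneg_right (mul_nonneg (add_nonneg (by positivity) (div_nonneg hT0 hdB.le)) hdI.le))
  · rw [dist_add_self]
    have e : (2 * (∑ i, ‖u i‖) / sb + (∑ i, ‖u i‖) / dI + (∑ i, ‖u i‖) / dB) * dB =
        (∑ i, ‖u i‖) + (2 * (∑ i, ‖u i‖) / sb + (∑ i, ‖u i‖) / dI) * dB := by
      rw [show 2 * (∑ i, ‖u i‖) / sb + (∑ i, ‖u i‖) / dI + (∑ i, ‖u i‖) / dB =
        (∑ i, ‖u i‖) / dB + (2 * (∑ i, ‖u i‖) / sb + (∑ i, ‖u i‖) / dI) by ring, add_mul, div_mul_cancel₀ _ hdB.ne']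
    rw [e]
    exact (hTi i).trans (le_add_of_nonneg_right (mul_nonneg (add_nonneg (by positivity) (div_nonneg hT0 hdI.le)) hdB.le))

/-- ★★ **THE LINEAR TUBE BOOTSTRAP (PROVED)**: if `z` lies in the tube of SOME gauge `t` and satisfies, at every gauge `l ≥ 0` with `z ∈ T(lρᵒ)`, the
AFFINE RESPONSE BOUND `z ∈ T(A + l·K)` with `A ≤ m·ρᵒ` (`m ≥ 0`) and `K ≤ qN·ρᵒ` (`0 ≤ qN < 1`), then `z ∈ T(A + (m/(1 − qN))·K)` — no outer tube.
[YT g71, carried g72] -/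
theorem bondTube_linear_bootstrap {z : Fin n → E3} {As AI AB Ks KI KB m qN t : ℝ} (hsb : 0 < sb) (hdI : 0 < dI) (hdB : 0 < dB)
    (hq0 : 0 ≤ qN) (hq1 : qN < 1) (hm : 0 ≤ m) (hAs : As ≤ m * sb) (hAI : AI ≤ m * dI) (hAB : AB ≤ m * dB) (hcs : Ks ≤ qN * sb)
    (hcI : KI ≤ qN * dI) (hcB : KB ≤ qN * dB) (ht : z ∈ bondTube X Rg (t * sb) (t * dI) (t * dB) y₀)
    (hclaim : ∀ lam : ℝ, 0 ≤ lam → z ∈ bondTube X Rg (lam * sb) (lam * dI) (lam * dB) y₀ →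
      z ∈ bondTube X Rg (As + lam * Ks) (AI + lam * KI) (AB + lam * KB) y₀) :
    z ∈ bondTube X Rg (As + m / (1 - qN) * Ks) (AI + m / (1 - qN) * KI) (AB + m / (1 - qN) * KB) y₀ := by
  have hfix : z ∈ bondTube X Rg (m / (1 - qN) * sb) (m / (1 - qN) * dI) (m / (1 - qN) * dB) y₀ := by
    refine linear_bootstrap (P := fun l => z ∈ bondTube X Rg (l * sb) (l * dI) (l * dB) y₀) hm hq0 hq1
      (fun l l' hll' hl => bondTube_mono (mul_le_mul_of_nonneg_right hll' hsb.le) (mul_le_mul_of_nonneg_right hll' hdI.le)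
        (mul_le_mul_of_nonneg_right hll' hdB.le) hl)
      (fun l hl => mem_bondTube_of_forall_gt hsb hdI hdB hl) ht fun l hl0 hl => ?_
    have hs' := mul_le_mul_of_nonneg_left hcs hl0
    have hI' := mul_le_mul_of_nonneg_left hcI hl0
    have hB' := mul_le_mul_of_nonneg_left hcB hl0
    exact bondTube_mono (by linarith) (by linarith) (by linarith) (hclaim l hl0 hl)
  exact hclaim _ (div_nonneg hm (sub_pos.2 hq1).le) hfix

end Engines

/-! ### YV-1  Class-parametrised currencies; the X-currencies are the instance `I i := ∃ p ∈ X, dist (y₀ i) p ≤ Rg` (PROVED, `rfl`) -/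

section ClassCurrency

variable {n : ℕ}

/-- ★ **`bondTubeC I Rg sb dI dB y₀`** — the vector bond tube of part YOA with the interface/bulk partition supplied by an ABSTRACT class `I` (interface
sites `I i` carry the tight pin `dI`).  `bondTube X … = bondTubeC (X-class at Rg) …` by `rfl` (`bondTube_eq_bondTubeC`). [this file, g72] -/
def bondTubeC (I : Fin n → Prop) (Rg sb dI dB : ℝ) (y₀ : Fin n → E3) : Set (Fin n → E3) :=
  {z | ∀ i j, dist (y₀ i) (y₀ j) ≤ Rg → dist (z i - z j) (y₀ i - y₀ j) ≤ sb} ∩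
    ({z | ∀ i, I i → dist (z i) (y₀ i) ≤ dI} ∩ {z | ∀ i, dist (z i) (y₀ i) ≤ dB})

/-- **`IsTubeFluxC I Rφ Mg MI Mb y₀ g b`** — admissible flux of class levels `(Mg, MI, Mb)` for the abstract class `I` (part YQ's `IsTubeFlux`, class
abstracted). [this file, g72] -/
def IsTubeFluxC (I : Fin n → Prop) (Rφ Mg MI Mb : ℝ) (y₀ : Fin n → E3) (g : Fin n → Fin n → E3) (b : Fin n → E3) : Prop :=
  (∀ i j, g j i = -g i j) ∧ (∀ i j, Rφ < dist (y₀ i) (y₀ j) → g i j = 0) ∧ (∀ i j, ‖g i j‖ ≤ Mg) ∧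
    (∀ i, I i → ‖b i‖ ≤ MI) ∧ ∀ i, ¬ I i → ‖b i‖ ≤ Mb

/-- ★ **`HasTubeFluxLoadC I Rφ Mg MI Mb y₀ φ`** — the load `φ` has tube flux levels `(Mg, MI, Mb)` for the abstract class `I`;
`HasTubeFluxLoad X Rg Rφ … ↔ HasTubeFluxLoadC (X-class at Rg) Rφ …` by `Iff.rfl`. [this file, g72] -/
def HasTubeFluxLoadC (I : Fin n → Prop) (Rφ Mg MI Mb : ℝ) (y₀ : Fin n → E3) (φ : (Fin n → E3) →L[ℝ] ℝ) : Prop :=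
  ∃ (g : Fin n → Fin n → E3) (b : Fin n → E3), IsTubeFluxC I Rφ Mg MI Mb y₀ g b ∧ IsFluxRep φ g b

/-- the X-tube is the class tube of the X-class (definitional). [this file, g72] -/
theorem bondTube_eq_bondTubeC (X : Set E3) (Rg sb dI dB : ℝ) (y₀ : Fin n → E3) :
    bondTube X Rg sb dI dB y₀ = bondTubeC (fun i => ∃ p ∈ X, dist (y₀ i) p ≤ Rg) Rg sb dI dB y₀ := rfl

/-- the X-flux currency is the class currency of the X-class (definitional). [this file, g72] -/
theorem hasTubeFluxLoad_iff_hasTubeFluxLoadC {X : Set E3} {Rg Rφ Mg MI Mb : ℝ} {y₀ : Fin n → E3} {φ : (Fin n → E3) →L[ℝ] ℝ} :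
    HasTubeFluxLoad X Rg Rφ Mg MI Mb y₀ φ ↔ HasTubeFluxLoadC (fun i => ∃ p ∈ X, dist (y₀ i) p ≤ Rg) Rφ Mg MI Mb y₀ φ := Iff.rfl

end ClassCurrency

/-! ### YV-2  Placed perfect patches, fatness, and the collar registration of a RIGID reference -/

section RigidReference

variable {n : ℕ}

/-- ★ **`IsPlacedPerfectPatch aHi δ θ a s Λ X′ Y`** — `(X′, Y)` is a perfect clamped patch of a PLACED crystal: `Y` injectively enumerates finitely many
sites of the image `g '' H′` under an ISOMETRY `g` of `E3` of a rooted equilibrium-chart crystal `H′ = LayeredHom L′ w′` (`IsEquilChart`, `aHi`-door set at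
separation `δ`, θ-good, summable — the configuration-level binders of (Gh)), and `X′ = g '' H′ ∖ range Y` is ALL the rest.  The placement lets the patch
sit AT the actual core (a rigid reference cannot be re-rooted); Euclidean covariance is the cert's burden. [this file, g72] -/
def IsPlacedPerfectPatch (aHi δ θ a s Λ : ℝ) (X' : Set E3) (Y : Fin n → E3) : Prop :=
  ∃ (L : E3 ≃L[ℝ] E3) (w : ℤ → E3) (g : E3 → E3), Isometry g ∧ IsEquilChart a s Λ L w ∧ IsDoorSetP aHi δ (LayeredHom (L : E3 →L[ℝ] E3) w) ∧
    (∀ p ∈ LayeredHom (L : E3 →L[ℝ] E3) w, IsTwoShellAffineGood θ (LayeredHom (L : E3 →L[ℝ] E3) w) p) ∧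
      (∀ z : E3, Summable fun y : LayeredHom (L : E3 →L[ℝ] E3) w => lennardJones (dist z (y : E3))) ∧
        Function.Injective Y ∧ Set.range Y ⊆ g '' LayeredHom (L : E3 →L[ℝ] E3) w ∧ X' = g '' LayeredHom (L : E3 →L[ℝ] E3) w \ Set.range Y

/-- ★ **`IsFatPatch q ρi ρo X′ Y`** — the patch is CORE-SHAPED (row 1295 (Gl-∀)): for a finite-radius anchor set `K′` in a `q`-ball, NO exterior atom of
`X′` lies within `ρi` of `K′` and EVERY site of `Y` lies within `ρo` of `K′`.  For a rigid collar-registered reference it is DERIVED with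
`(ρi, ρo) = (ρ − ε, ρ + dm)` (part YW, PROVED). [this file, g72] -/
def IsFatPatch (q ρi ρo : ℝ) (X' : Set E3) (Y : Fin n → E3) : Prop :=
  ∃ (x₀ : E3) (K' : Set E3), (∀ k ∈ K', dist k x₀ ≤ q) ∧ (∀ p' ∈ X', ∀ k ∈ K', ρi < dist p' k) ∧ ∀ i, ∃ k ∈ K', dist (Y i) k ≤ ρo

/-- ★ **`IsCollarRegistered ε Rl Rg Ru B X X′ Y`** — the perfect exterior `X′` of a rigid reference `Y` (the patch's OWN sites) is registered to the
actual exterior `X` on the zone `B`: (S1)/(S2) the CLASS SANDWICH `X′-class(Rl) ⊆ X-class(Rg) ⊆ X′-class(Ru)` at every site (what makes the transport of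
(Gl♯) to X-currency exact), and (M1)/(M2) two-sided ABSOLUTE matching `≤ ε` of every atom of `X` resp. `X′` lying in `B` (what feeds (Gp♯); no radius:
the whole cool zone is matched to ONE crystal — possible only because the reference IS that crystal). [this file, g72] -/
def IsCollarRegistered (ε Rl Rg Ru : ℝ) (B X X' : Set E3) (Y : Fin n → E3) : Prop :=
  (∀ i, (∃ p' ∈ X', dist (Y i) p' ≤ Rl) → ∃ p ∈ X, dist (Y i) p ≤ Rg) ∧ (∀ i, (∃ p ∈ X, dist (Y i) p ≤ Rg) → ∃ p' ∈ X', dist (Y i) p' ≤ Ru) ∧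
    (∀ p ∈ X, p ∈ B → ∃ p' ∈ X', dist p p' ≤ ε) ∧ ∀ p' ∈ X', p' ∈ B → ∃ p ∈ X, dist p p' ≤ ε

/-- collar registration is WEAKER for a larger tolerance and a wider band. [this file, g72] -/
theorem IsCollarRegistered.mono {ε ε' Rl Rl' Rg Ru Ru' : ℝ} (hε : ε ≤ ε') (hl : Rl' ≤ Rl) (hu : Ru ≤ Ru') {B X X' : Set E3} {Y : Fin n → E3}
    (h : IsCollarRegistered ε Rl Rg Ru B X X' Y) : IsCollarRegistered ε' Rl' Rg Ru' B X X' Y := by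
  obtain ⟨h1, h2, h3, h4⟩ := h
  refine ⟨fun i ⟨p', hp', hd⟩ => h1 i ⟨p', hp', hd.trans hl⟩, fun i hi => ?_, fun p hp hB => ?_, fun p' hp' hB => ?_⟩
  · obtain ⟨p', hp', hd⟩ := h2 i hi; exact ⟨p', hp', hd.trans hu⟩
  · obtain ⟨p', hp', hd⟩ := h3 p hp hB; exact ⟨p', hp', hd.trans hε⟩
  · obtain ⟨p, hp, hd⟩ := h4 p' hp' hB; exact ⟨p, hp, hd.trans hε⟩

end RigidReference

/-! ### YV-3  The pieces (XR♯) / (Gl♯) / (Gp♯) and the restricted target (Gh♯) (typed; binders of (QE)/(Gh) verbatim; every constant symbolic) -/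

section Pieces

/-- ★★ **(XR♯) «RigidReferenceP … Rg sb dI dB ε Rl Ru …» — A RIGID COLLAR-REGISTERED TUBE REFERENCE EXISTS.**  Under the binders of (QE) verbatim: there are
a reference filling `y₀` with `IsTubeReference ϑ₀ ϑ dm Rg sb dI dB (S ∖ core) (LayeredHom L w) xf y₀` (as (XR)) which IS a placed perfect clamped patch
`(X′, y₀)` at the binders' `(δ, a)`, with `X′` collar-registered to `S ∖ core` on the cool zone `dist(·, K) < r + rsh` within `ε` and class band `[Rl, Ru]`
about `Rg`.  SPECIAL∃ · KINEMATIC · ATTACKABLE (fit ONE crystal — stacking word read off the `ϑc`-cool collar, a ball has trivial monodromy — rigidly to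
the whole collar, continue it through the core, `y₀ :=` its sites matched to `xf`) · STRONGER than (XR) · INSTRUMENTABLE «RigidFit-T» (rigid crystal fit to
sampled cool collars: max residual `ε`, interface-star misfit `ϑ₀`, matching distance to the mild core, class flips in the band).
Why it might fail: (a) RIGID MISFIT — a `ϑc`-cool collar may carry uniform strain/bend `ϑc/4` per unit length, so ONE rigid crystal misses it by
`≈ (ϑc/4)·(ρ + Rg)`: needs `ε, ϑ₀ ≳ 5ϑc` — free in the `∃ ϑm` column, but it rules out the record dial `ϑm = 1/2000` for this line (F. John 1961: no
rigid registration of a bent frame at small absolute tolerance); (b) REGISTRY SLIP / matching `dm = 1/2` against the `1/10`-mild core exactly as (XR);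
(c) CLASS BAND: zone-matched atoms need only `Rl + ε ≤ Rg ≤ Ru − ε`; an UNMATCHED (warm, `dist(·, K) ≥ r + rsh`) atom within `Ru` of a site puts that
site in the outer boundary layer (`dist(·, K) ≥ r + rsh − Ru`), where its tame-moat and crystal nearest neighbours (distance `≈ 1 ≤ Rl`) supply both classes.
Sources: part YO (XR); part YF (frame step); part TR (FJM); F. John, CPAM 14 (1961); Ariza–Ortiz, ARMA 178 (2005); this file's header. [this file, g72] -/
def RigidReferenceP (ϑc ϑ ϑp r q rsh ρ rm dm ϑ₀ Rg sb dI dB ε Rl Ru aHi Λ θ s : ℝ) : Prop :=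
  ∀ δ : ℝ, 0 < δ → ∀ a : ℝ, 0 < a →
    ∀ S : Set E3, IsDoorSetP aHi δ S → (∀ z : E3, Summable fun y : S => lennardJones (dist z (y : E3))) →
      (∀ p ∈ S, IsTwoShellAffineGood θ S p) →
        ∀ (L : E3 ≃L[ℝ] E3) (w : ℤ → E3), IsEquilChart a s Λ L w →
          ∀ (x₀ : E3) (K : Set E3), K ⊆ S → (∀ k ∈ K, dist k x₀ ≤ q) →
            IsTameOn ϑp S (LayeredHom (L : E3 →L[ℝ] E3) w) (coreOf S K rm) →
              IsTameOn ϑc S (LayeredHom (L : E3 →L[ℝ] E3) w) (moatIn S K r (r + rsh)) →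
                ∀ (n : ℕ) (xf : Fin n → E3), Function.Injective xf → Set.range xf = coreOf S K ρ →
                  ∃ (y₀ : Fin n → E3) (X' : Set E3),
                    IsTubeReference ϑ₀ ϑ dm Rg sb dI dB (S \ coreOf S K ρ) (LayeredHom (L : E3 →L[ℝ] E3) w) xf y₀ ∧
                      IsPlacedPerfectPatch aHi δ θ a s Λ X' y₀ ∧
                        IsCollarRegistered ε Rl Rg Ru {z | ∃ k ∈ K, dist z k < r + rsh} (S \ coreOf S K ρ) X' y₀

/-- ★★★ **(Gl♯) «PlacedPerfectResponseP q ρi ρo Rl Ru Rg Rφ GsG … GBB aHi Λ θ s» — CLASS-SPLIT MAX-NORM RESPONSE OF THE FAT PLACED PERFECT CLAMPED PATCH,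
UNIFORMLY OVER THE CLASSIFICATION BAND.**  For every `δ, a > 0` and placed perfect clamped patch `(X′, Y)` that is `(q, ρi, ρo)`-fat: `clampedEnergy X′` is
twice differentiable at `Y` with tangent stiffness `A`, and for EVERY class `I` with `X′-class(Rl) ⊆ I ⊆ X′-class(Ru)` and every displacement `u` whose
harmonic load `A u` has `I`-class levels `(Mg, MI, Mb) ≥ 0` (flux radius `Rφ`), `Y + u ∈ bondTubeC I Rg (Σ_c Gs_c M_c) (Σ_c GI_c M_c) (Σ_c GB_c M_c) Y`.
CONFIGURATION-FREE · SPECIAL · CERT-type · INSTRUMENTABLE «GreenRow-T(perfect, band)» (one sparse factorisation per (word, core shape); the band adds the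
finitely many classifications of the threshold shell).
Why it might fail: by SIZE only (Born-stable close packings): rows `∝ ρo` / `∝ log ρo`; the clean scale window; a wide band re-classifying a whole shell
(keep `Ru − Rl` at a few `ε`); ragged fuzz of width `ρo − ρi = ε + dm` at the rim.
Sources: held part YT (Gl) of g71; E–Ming 2007 §2; Ortner–Theil 2013 §6; Ehrlacher–Ortner–Shapeev 2016; Wallace 1972; row 1295 (Gl-∀), (ρ1′). [this file, g72] -/
def PlacedPerfectResponseP (q ρi ρo Rl Ru Rg Rφ GsG GsI GsB GIG GII GIB GBG GBI GBB aHi Λ θ s : ℝ) : Prop :=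
  ∀ δ : ℝ, 0 < δ → ∀ a : ℝ, 0 < a →
    ∀ (n : ℕ) (X' : Set E3) (Y : Fin n → E3), IsPlacedPerfectPatch aHi δ θ a s Λ X' Y → IsFatPatch q ρi ρo X' Y →
      ∃ A : (Fin n → E3) →L[ℝ] ((Fin n → E3) →L[ℝ] ℝ),
        HasFDerivAt (fun z : Fin n → E3 => fderiv ℝ (fun z : Fin n → E3 => clampedEnergy X' z) z) A Y ∧
          ∀ I : Fin n → Prop, (∀ i, (∃ p' ∈ X', dist (Y i) p' ≤ Rl) → I i) → (∀ i, I i → ∃ p' ∈ X', dist (Y i) p' ≤ Ru) →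
            ∀ u : Fin n → E3, ∀ Mg MI Mb : ℝ, 0 ≤ Mg → 0 ≤ MI → 0 ≤ Mb → HasTubeFluxLoadC I Rφ Mg MI Mb Y (A u) →
              Y + u ∈ bondTubeC I Rg (GsG * Mg + GsI * MI + GsB * Mb) (GIG * Mg + GII * MI + GIB * Mb) (GBG * Mg + GBI * MI + GBB * Mb) Y

/-- ★★ **(Gp♯) «CollarPinDriftP … Rg sb dI dB Rφ ε Rl Ru κg κI κb …» — THE PIN MISMATCH OF A RIGID COLLAR-REGISTERED REFERENCE IS GAUGE-SMALL.**  Under the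
binders of (Gh) verbatim, for every tube reference `y₀` that is a placed perfect clamped patch `(X′, y₀)` collar-registered to `S ∖ core` (zone
`dist(·, K) < r + rsh`, tolerance `ε`, band `[Rl, Ru]`), the tangent stiffnesses `H` of `clampedEnergy (S ∖ core)` and `A` of `clampedEnergy X′` AT THE SAME
POINT `y₀`, and every displacement `u` of gauge `l ≥ 0`: the defect load `H u − A u` has class levels `l·(κg, κI, κb)` about `y₀`.  FORWARD: the core's
interaction energy is the SAME function in both clamped energies, so `H − A` is the Hessian of `Σᵢ (Σ_{p ∈ X} V(zᵢ − p) − Σ_{p′ ∈ X′} V(zᵢ − p′))` —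
SITE-DIAGONAL, NO core–core term, `κg = 0` admissible; `‖P_i(X) − P_i(X′)‖ ≤ ε·Σ_{cool} |D³V| + Σ_{warm} |D²V|` (both sides), warm atoms at distance
`≥ r + rsh − ρ − dm − depth(i)`.  GENERIC · ANALYTIC · ATTACKABLE · INSTRUMENTABLE «PinDrift-R».
Why it might fail: SIZE only — outermost interface sites see the warm host from distance `≈ 3.5` (`2π(3.5) ≈ 0.27` of `κI/dI`); `GB_I` unmeasured;
compressed cool bonds have larger `|D³V|` (absorbed by the free `ε`).
Sources: held part YT (Gp) of g71 (`|V‴(a₀)| ≈ 207`, `c_tail`); E–Ming 2007 §2; Ortner–Theil 2013; this file's header (Gr-3). [this file, g72] -/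
def CollarPinDriftP (ϑc ϑ ϑp r q rsh ρ rm dm ϑ₀ Rg sb dI dB Rφ ε Rl Ru κg κI κb aHi Λ θ s : ℝ) : Prop :=
  ∀ δ : ℝ, 0 < δ → ∀ a : ℝ, 0 < a →
    ∀ S : Set E3, IsDoorSetP aHi δ S → (∀ z : E3, Summable fun y : S => lennardJones (dist z (y : E3))) →
      (∀ p ∈ S, IsTwoShellAffineGood θ S p) →
        ∀ (L : E3 ≃L[ℝ] E3) (w : ℤ → E3), IsEquilChart a s Λ L w →
          ∀ (x₀ : E3) (K : Set E3), K ⊆ S → (∀ k ∈ K, dist k x₀ ≤ q) →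
            IsTameOn ϑp S (LayeredHom (L : E3 →L[ℝ] E3) w) (coreOf S K rm) →
              IsTameOn ϑc S (LayeredHom (L : E3 →L[ℝ] E3) w) (moatIn S K r (r + rsh)) →
                ∀ (n : ℕ) (xf : Fin n → E3), Function.Injective xf → Set.range xf = coreOf S K ρ →
                  ∀ y₀ : Fin n → E3, IsTubeReference ϑ₀ ϑ dm Rg sb dI dB (S \ coreOf S K ρ) (LayeredHom (L : E3 →L[ℝ] E3) w) xf y₀ →
                    ∀ X' : Set E3, IsPlacedPerfectPatch aHi δ θ a s Λ X' y₀ →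
                      IsCollarRegistered ε Rl Rg Ru {z | ∃ k ∈ K, dist z k < r + rsh} (S \ coreOf S K ρ) X' y₀ →
                        ∀ H : (Fin n → E3) →L[ℝ] ((Fin n → E3) →L[ℝ] ℝ),
                          HasFDerivAt (fun z : Fin n → E3 => fderiv ℝ (fun z : Fin n → E3 => clampedEnergy (S \ coreOf S K ρ) z) z) H y₀ →
                            ∀ A : (Fin n → E3) →L[ℝ] ((Fin n → E3) →L[ℝ] ℝ),
                              HasFDerivAt (fun z : Fin n → E3 => fderiv ℝ (fun z : Fin n → E3 => clampedEnergy X' z) z) A y₀ →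
                                ∀ u : Fin n → E3, ∀ l : ℝ, 0 ≤ l →
                                  y₀ + u ∈ bondTube (S \ coreOf S K ρ) Rg (l * sb) (l * dI) (l * dB) y₀ →
                                    HasTubeFluxLoad (S \ coreOf S K ρ) Rg Rφ (l * κg) (l * κI) (l * κb) y₀ (H u - A u)

/-- ★★ **(Gh♯) «RigidHarmonicResponseP … Rg sb dI dB Rφ ε Rl Ru HsG … HBB …» — (Gh) RESTRICTED TO RIGID COLLAR-REGISTERED REFERENCES.**  Part YS's
`HarmonicResponseP` with the reference additionally a placed perfect clamped patch `(X′, y₀)` collar-registered to the exterior: for the tangent stiffness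
`H` at `y₀`, every `u` with harmonic load of class levels `M ≥ 0` has `y₀ + u ∈ T(H·M)`.  WEAKER than (Gh) (part YW `HarmonicResponseP.rigid`); the target
of the node (part YW `rigidHarmonicResponseP_of_placed`) and the input of the rigid chain. [this file, g72] -/
def RigidHarmonicResponseP (ϑc ϑ ϑp r q rsh ρ rm dm ϑ₀ Rg sb dI dB Rφ ε Rl Ru HsG HsI HsB HIG HII HIB HBG HBI HBB aHi Λ θ s : ℝ) : Prop :=
  ∀ δ : ℝ, 0 < δ → ∀ a : ℝ, 0 < a →
    ∀ S : Set E3, IsDoorSetP aHi δ S → (∀ z : E3, Summable fun y : S => lennardJones (dist z (y : E3))) →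
      (∀ p ∈ S, IsTwoShellAffineGood θ S p) →
        ∀ (L : E3 ≃L[ℝ] E3) (w : ℤ → E3), IsEquilChart a s Λ L w →
          ∀ (x₀ : E3) (K : Set E3), K ⊆ S → (∀ k ∈ K, dist k x₀ ≤ q) →
            IsTameOn ϑp S (LayeredHom (L : E3 →L[ℝ] E3) w) (coreOf S K rm) →
              IsTameOn ϑc S (LayeredHom (L : E3 →L[ℝ] E3) w) (moatIn S K r (r + rsh)) →
                ∀ (n : ℕ) (xf : Fin n → E3), Function.Injective xf → Set.range xf = coreOf S K ρ →
                  ∀ y₀ : Fin n → E3, IsTubeReference ϑ₀ ϑ dm Rg sb dI dB (S \ coreOf S K ρ) (LayeredHom (L : E3 →L[ℝ] E3) w) xf y₀ →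
                    ∀ X' : Set E3, IsPlacedPerfectPatch aHi δ θ a s Λ X' y₀ →
                      IsCollarRegistered ε Rl Rg Ru {z | ∃ k ∈ K, dist z k < r + rsh} (S \ coreOf S K ρ) X' y₀ →
                        ∀ H : (Fin n → E3) →L[ℝ] ((Fin n → E3) →L[ℝ] ℝ),
                          HasFDerivAt (fun z : Fin n → E3 => fderiv ℝ (fun z : Fin n → E3 => clampedEnergy (S \ coreOf S K ρ) z) z) H y₀ →
                            ∀ u : Fin n → E3, ∀ Mg MI Mb : ℝ, 0 ≤ Mg → 0 ≤ MI → 0 ≤ Mb →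
                              HasTubeFluxLoad (S \ coreOf S K ρ) Rg Rφ Mg MI Mb y₀ (H u) →
                                y₀ + u ∈ bondTube (S \ coreOf S K ρ) Rg (HsG * Mg + HsI * MI + HsB * Mb) (HIG * Mg + HII * MI + HIB * Mb)
                                  (HBG * Mg + HBI * MI + HBB * Mb) y₀

end Pieces

end Summit.AtomisticToContinuum.Crystallization.Theorems.ChartedZeroExcessLayeredLatticeLiouville

end
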